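import Summits.HodgeConjecture.HodgeConjecture.Theorems.LinearSystemTorelliLocalTubeSpanSp2Closure
import Summits.HodgeConjecture.HodgeConjecture.Theorems.LinearSystemTorelliLocalTubeSpanLatticeCoordinates
import Summits.HodgeConjecture.HodgeConjecture.Theorems.LinearSystemTorelliLocalTubeSpanUnimodularTransitivityLocal
import Summits.HodgeConjecture.HodgeConjecture.Theorems.LinearSystemTorelliLocalTubeSpanThreeSquares

/-!
# Route LinearSystemTorelli — crux `LocalTubeSpan` (stmt-HodgeConjecture-2490): THEOREM U⁺, the dual-basis step

Helper file of line `Sketch`, cycle 10 (continuation lead c7), for THEOREM U⁺: for a lattice `Λ = ℤS`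
spanning the NONDEGENERATE space `V`, with `B` alternating and integral on `S`, containing a unimodular
pair, and ANY `G ≤ GL(V)` containing a unit acting as `T_a² : v ↦ v - 2⟨v,a⟩a` for every `a ∈ Λ`, every
unit satisfying the four `Sp♯₂(Λ)` conditions (the hypotheses of `Janssen1983_thm2_5`) lies in `G` — with
NO unimodularity hypothesis on `Λ` (cycle 9's Theorem U needed `Λ/rad` unimodular).

The proof is an induction along a ℤ-basis `b = (u, w, n₃, …)` of `Λ` with its `B`-dual family `yv`
(`⟨yv i, b j⟩ = δᵢⱼ`): an element of `Sp♯₂(Λ)` fixing `{b₀, …, b_k}^⊥` is corrected, by an element of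
`G ∩ Sp♯₂(Λ)` fixing `{b₀, …, b_k}^⊥`, to fix `{b₀, …, b_{k-1}}^⊥` — one moves the DUAL vector `yv k`
back.  This file proves that step (`localTubeSpan_theoremUplus_step`) from three inputs:

* `g (yv k) - yv k ∈ 2Λ` (`localTubeSpan_dualMove`, here a hypothesis `hdm`), and its coordinates beyond
  `k` vanish, so it lies in `Λ_k = ℤ⟨b₀..b_k⟩`;
* for `k ≥ 2` THE ASYMMETRIC ENGINE (`localTubeSpan_asymEngine`, here a hypothesis `heng`): squares along
  vectors of `Λ_k` move `g (yv k)` back to `yv k`, the plane `⟨b₀, b₁⟩ = ⟨u, w⟩ ⊆ Λ_k` being the catalyst;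
* for `k = 1` the symmetric engine of cycle 7 (`localTubeSpan_unimodularTransitivity_local`) on the
  plane (`yv 1 = u`), and for `k = 0` a power of `T_u²` (`yv 0 = -w` up to `Λ₀ = ℤu`).

No named facts; no `sorry`.
-/

-- `Summit.HodgeConjecture.HodgeConjecture.Theorems` is the mandated namespace (single-conjunct summit:
-- Sub = Summit), which `linter.dupNamespace` flags on every declaration; the lakefile turns the
-- linter off tree-wide (weak option), restated here so stand-alone elaboration is warning-free too.
set_option linter.dupNamespace false

noncomputable section

open Literature.AlgebraicGeometry.HodgeTheory

namespace Summit.HodgeConjecture.HodgeConjecture.Theorems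

variable {V : Type} [AddCommGroup V] [Module ℚ V]

/-- Coordinates along an integral generating family with a dual family: for `a ∈ Λ`, `a = Σ cᵢ bᵢ` with
`cⱼ = ⟨yv j, a⟩`; hence a lattice vector killed by `yv j` for all `j` above `k` is a combination of
`b₀, …, b_k`, and is orthogonal to every vector orthogonal to `b₀, …, b_k`. [folklore] -/
theorem localTubeSpan_theoremUplus_coord (B : LinearMap.BilinForm ℚ V) (S : Set V) {n : ℕ}
    (b yv : Fin n → V)
    (hcoord : ∀ x ∈ Submodule.span ℤ S, ∃ c : Fin n → ℤ, x = ∑ i, ((c i : ℤ) : ℚ) • b i)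
    (hdual : ∀ i j, B (yv i) (b j) = if i = j then 1 else 0) {k : ℕ}
    {a : V} (ha : a ∈ Submodule.span ℤ S) (hak : ∀ j : Fin n, k < (j : ℕ) → B (yv j) a = 0)
    (v : V) (hv : ∀ i : Fin n, (i : ℕ) ≤ k → B v (b i) = 0) : B v a = 0 := by
  classical
  obtain ⟨c, rfl⟩ := hcoord a ha
  have hc : ∀ j : Fin n, k < (j : ℕ) → c j = 0 := by
    intro j hj
    have h := hak j hj
    simp only [map_sum, map_smul, smul_eq_mul, hdual, mul_ite, mul_one, mul_zero,
      Finset.sum_ite_eq, Finset.mem_univ, if_true] at h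
    exact_mod_cast h
  simp only [map_sum, map_smul, smul_eq_mul]
  refine Finset.sum_eq_zero fun i _ => ?_
  by_cases hi : (i : ℕ) ≤ k
  · rw [hv i hi, mul_zero]
  · rw [hc i (lt_of_not_ge hi), Int.cast_zero, zero_mul]


/-- In a nondegenerate space spanned by the lattice, a vector orthogonal to every member of an integral
generating family is zero. [folklore] -/
theorem localTubeSpan_theoremUplus_eq_zero_of_orth (B : LinearMap.BilinForm ℚ V)
    (hnd : B.Nondegenerate) (S : Set V) (hsp : Submodule.span ℚ S = ⊤) {n : ℕ} (b : Fin n → V)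
    (hcoord : ∀ x ∈ Submodule.span ℤ S, ∃ c : Fin n → ℤ, x = ∑ i, ((c i : ℤ) : ℚ) • b i)
    (v : V) (hv : ∀ j, B v (b j) = 0) : v = 0 := by
  classical
  refine hnd.1 v fun x => ?_
  have hS : ∀ s ∈ Submodule.span ℤ S, B v s = 0 := by
    intro s hs
    obtain ⟨c, rfl⟩ := hcoord s hs
    simp only [map_sum, map_smul, smul_eq_mul, hv, mul_zero, Finset.sum_const_zero]
  have hx : x ∈ Submodule.span ℚ S := by rw [hsp]; exact Submodule.mem_top
  induction hx using Submodule.span_induction with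
  | mem s hs => exact hS s (Submodule.subset_span hs)
  | zero => exact map_zero _
  | add s s' _ _ ihs ihs' => rw [map_add, ihs, ihs', add_zero]
  | smul q s _ ihs => rw [map_smul, ihs, smul_zero]

/-- **The dual-basis step of Theorem U⁺.**  Let `b, yv : Fin (n+2) → V` be an integral generating
family of `Λ = ℤS` with `b 0 = u`, `b 1 = w` a unimodular pair, `b i ⟂ u, w` for `i ≥ 2`, and its dual
family (`⟨yv i, b j⟩ = δᵢⱼ`), in a nondegenerate space; let `G` contain the squares `T_a²`, `a ∈ Λ`.
Granted the dual move (`hdm`) and the asymmetric engine (`heng`) as hypotheses, every unit `g` with the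
four `Sp♯₂(Λ)` conditions fixing `{b₀, …, b_k}^⊥` pointwise is corrected by some `q ∈ G` with the four
conditions, fixing `{b₀, …, b_k}^⊥`, and with `q (g (yv k)) = yv k`. [cite: Janssen1983, Thm. 2.5] -/
theorem localTubeSpan_theoremUplus_step [FiniteDimensional ℚ V] (B : LinearMap.BilinForm ℚ V)
    (hB : B.IsAlt) (hnd : B.Nondegenerate) (S : Set V) (hint : ∀ δ ∈ S, ∀ δ' ∈ S, ∃ n : ℤ, B δ δ' = n)
    (hsp : Submodule.span ℚ S = ⊤)
    (G : Subgroup (V →ₗ[ℚ] V)ˣ)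
    (hsq : ∀ a ∈ Submodule.span ℤ S, ∃ g ∈ G, ∀ v : V,
      ((g : (V →ₗ[ℚ] V)ˣ) : V →ₗ[ℚ] V) v = v - (2 : ℚ) • (B v a • a))
    {n : ℕ} (b yv : Fin (n + 2) → V) (hbmem : ∀ i, b i ∈ Submodule.span ℤ S)
    (hcoord : ∀ x ∈ Submodule.span ℤ S, ∃ c : Fin (n + 2) → ℤ, x = ∑ i, ((c i : ℤ) : ℚ) • b i)
    (hdual : ∀ i j, B (yv i) (b j) = if i = j then 1 else 0)
    (huw : B (b 0) (b 1) = 1) (hbo : ∀ i : Fin (n + 2), 2 ≤ (i : ℕ) → B (b i) (b 0) = 0 ∧ B (b i) (b 1) = 0)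
    (hdm : ∀ (y : V), (∀ a ∈ Submodule.span ℤ S, ∃ z : ℤ, B y a = z) → ∀ g : (V →ₗ[ℚ] V)ˣ,
      (∀ x ∈ Submodule.span ℤ S, (g : V →ₗ[ℚ] V) x ∈ Submodule.span ℤ S) →
      (∀ l : V →ₗ[ℚ] ℚ, (∀ x ∈ Submodule.span ℤ S, ∃ z : ℤ, l x = z) →
        ∃ v ∈ Submodule.span ℤ S, ∀ x ∈ Submodule.span ℤ S, l ((g : V →ₗ[ℚ] V) x - x) = 2 * B v x) →
      ∃ c ∈ Submodule.span ℤ S, (g : V →ₗ[ℚ] V) y = y + (2 : ℚ) • c)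
    (heng : ∀ (L : Set V), (∀ δ ∈ L, ∀ δ' ∈ L, ∃ m : ℤ, B δ δ' = m) → ∀ (Γ : Subgroup (V →ₗ[ℚ] V)ˣ),
      (∀ a ∈ Submodule.span ℤ L, ∃ g ∈ Γ, ∀ v : V,
        ((g : (V →ₗ[ℚ] V)ˣ) : V →ₗ[ℚ] V) v = v - (2 : ℚ) • (B v a • a)) →
      ∀ {u w δ : V}, u ∈ Submodule.span ℤ L → w ∈ Submodule.span ℤ L → δ ∈ Submodule.span ℤ L →
      B u w = 1 → B δ u = 0 → B δ w = 0 → ∀ (y : V), B y u = 0 → B y w = 0 → B y δ = 1 →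
      (∀ a ∈ Submodule.span ℤ L, ∃ z : ℤ, B y a = z) → ∀ {t : V},
      (∃ c ∈ Submodule.span ℤ L, t = y + (2 : ℚ) • c) → (∃ x ∈ Submodule.span ℤ L, B t x = 1) →
      ∃ g ∈ Γ, ((g : (V →ₗ[ℚ] V)ˣ) : V →ₗ[ℚ] V) t = y)
    (kk : Fin (n + 2)) (g : (V →ₗ[ℚ] V)ˣ)
    (h1 : ∀ x y : V, B ((g : V →ₗ[ℚ] V) x) ((g : V →ₗ[ℚ] V) y) = B x y)
    (h2 : ∀ x ∈ Submodule.span ℤ S, (g : V →ₗ[ℚ] V) x ∈ Submodule.span ℤ S)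
    (_h3 : ∀ x ∈ Submodule.span ℤ S, ((g⁻¹ : (V →ₗ[ℚ] V)ˣ) : V →ₗ[ℚ] V) x ∈ Submodule.span ℤ S)
    (h4 : ∀ l : V →ₗ[ℚ] ℚ, (∀ x ∈ Submodule.span ℤ S, ∃ z : ℤ, l x = z) →
      ∃ v ∈ Submodule.span ℤ S, ∀ x ∈ Submodule.span ℤ S, l ((g : V →ₗ[ℚ] V) x - x) = 2 * B v x)
    (hfix : ∀ v : V, (∀ i : Fin (n + 2), (i : ℕ) ≤ (kk : ℕ) → B v (b i) = 0) → (g : V →ₗ[ℚ] V) v = v) :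
    ∃ q ∈ G,
      ((∀ x y : V, B ((q : V →ₗ[ℚ] V) x) ((q : V →ₗ[ℚ] V) y) = B x y) ∧
        (∀ x ∈ Submodule.span ℤ S, (q : V →ₗ[ℚ] V) x ∈ Submodule.span ℤ S) ∧
        (∀ x ∈ Submodule.span ℤ S, ((q⁻¹ : (V →ₗ[ℚ] V)ˣ) : V →ₗ[ℚ] V) x ∈ Submodule.span ℤ S) ∧
        (∀ l : V →ₗ[ℚ] ℚ, (∀ x ∈ Submodule.span ℤ S, ∃ z : ℤ, l x = z) →
          ∃ v ∈ Submodule.span ℤ S, ∀ x ∈ Submodule.span ℤ S,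
            l ((q : V →ₗ[ℚ] V) x - x) = 2 * B v x)) ∧
      (∀ v : V, (∀ i : Fin (n + 2), (i : ℕ) ≤ (kk : ℕ) → B v (b i) = 0) → (q : V →ₗ[ℚ] V) v = v) ∧
      (q : V →ₗ[ℚ] V) ((g : V →ₗ[ℚ] V) (yv kk)) = yv kk := by
  classical
  set k : ℕ := (kk : ℕ) with hkdef
  set y : V := yv kk with hydef
  -- the `Sp♯₂` predicate and the fixing predicate, closed under the group operations
  let C : (V →ₗ[ℚ] V)ˣ → Prop := fun g =>
    (∀ a b : V, B ((g : V →ₗ[ℚ] V) a) ((g : V →ₗ[ℚ] V) b) = B a b) ∧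
    (∀ a ∈ Submodule.span ℤ S, (g : V →ₗ[ℚ] V) a ∈ Submodule.span ℤ S) ∧
    (∀ a ∈ Submodule.span ℤ S, ((g⁻¹ : (V →ₗ[ℚ] V)ˣ) : V →ₗ[ℚ] V) a ∈ Submodule.span ℤ S) ∧
    (∀ l : V →ₗ[ℚ] ℚ, (∀ a ∈ Submodule.span ℤ S, ∃ z : ℤ, l a = z) →
      ∃ v ∈ Submodule.span ℤ S, ∀ a ∈ Submodule.span ℤ S,
        l ((g : V →ₗ[ℚ] V) a - a) = 2 * B v a)
  have hCmul : ∀ g h, C g → C h → C (g * h) := fun g h hg hh =>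
    localTubeSpan_sp2Cond_mul B S g h hg.1 hg.2.1 hg.2.2.1 hg.2.2.2 hh.1 hh.2.1 hh.2.2.1 hh.2.2.2
  have hCinv : ∀ g, C g → C g⁻¹ := fun g hg =>
    localTubeSpan_sp2Cond_inv B S g hg.1 hg.2.1 hg.2.2.1 hg.2.2.2
  have hCone : C 1 := localTubeSpan_sp2Cond_one B S
  have hCsq : ∀ a ∈ Submodule.span ℤ S, ∀ g : (V →ₗ[ℚ] V)ˣ,
      (∀ v, (g : V →ₗ[ℚ] V) v = v - (2 : ℚ) • (B v a • a)) → C g := fun a ha g hg =>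
    localTubeSpan_sp2Cond_of_sqMove B S hB hint ha g hg
  let F : (V →ₗ[ℚ] V)ˣ → Prop := fun g =>
    ∀ v : V, (∀ i : Fin (n + 2), (i : ℕ) ≤ k → B v (b i) = 0) → (g : V →ₗ[ℚ] V) v = v
  have hFmul : ∀ g h, F g → F h → F (g * h) := fun g h hg hh v hv => by
    rw [Units.val_mul, Module.End.mul_apply, hh v hv, hg v hv]
  have hFinv : ∀ g, F g → F g⁻¹ := fun g hg v hv => by
    conv_lhs => rw [← hg v hv]
    rw [localTubeSpan_units_inv_apply_apply]
  have hFone : F 1 := fun v _ => by rw [Units.val_one, Module.End.one_apply]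
  let ΓK : Subgroup (V →ₗ[ℚ] V)ˣ :=
    { carrier := {g | g ∈ G ∧ C g ∧ F g}
      one_mem' := ⟨one_mem _, hCone, hFone⟩
      mul_mem' := fun {a b} ha hb => ⟨mul_mem ha.1 hb.1, hCmul a b ha.2.1 hb.2.1, hFmul a b ha.2.2 hb.2.2⟩
      inv_mem' := fun {a} ha => ⟨inv_mem ha.1, hCinv a ha.2.1, hFinv a ha.2.2⟩ }
  have hΓK : ∀ {g}, g ∈ ΓK ↔ g ∈ G ∧ C g ∧ F g := fun {g} => Iff.rfl
  -- the sublattice `Λ_k = {a ∈ Λ : ⟨yv j, a⟩ = 0 for j > k}` (as a set; it is a `ℤ`-submodule)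
  let L : Set V := {a | a ∈ Submodule.span ℤ S ∧ ∀ j : Fin (n + 2), k < (j : ℕ) → B (yv j) a = 0}
  have hLspan : ∀ a ∈ Submodule.span ℤ L, a ∈ L := by
    intro a ha
    induction ha using Submodule.span_induction with
    | mem a ha => exact ha
    | zero => exact ⟨Submodule.zero_mem _, fun j _ => map_zero _⟩
    | add a a' _ _ iha iha' =>
      exact ⟨Submodule.add_mem _ iha.1 iha'.1, fun j hj => by rw [map_add, iha.2 j hj, iha'.2 j hj, add_zero]⟩
    | smul m a _ iha =>
      exact ⟨Submodule.smul_mem _ _ iha.1, fun j hj => by rw [map_zsmul, iha.2 j hj, smul_zero]⟩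
  have hintL : ∀ δ ∈ L, ∀ δ' ∈ L, ∃ m : ℤ, B δ δ' = m := fun δ hδ δ' hδ' =>
    localTubeSpan_integral_span B S hint hδ.1 hδ'.1
  -- a vector of `Λ_k` is orthogonal to every vector orthogonal to `b₀, …, b_k`
  have hLorth : ∀ a ∈ L, ∀ v : V, (∀ i : Fin (n + 2), (i : ℕ) ≤ k → B v (b i) = 0) → B v a = 0 :=
    fun a ha v hv => localTubeSpan_theoremUplus_coord B S b yv hcoord hdual ha.1 ha.2 v hv
  -- squares along vectors of `Λ_k` lie in `ΓK`
  have hsqL : ∀ a ∈ Submodule.span ℤ L, ∃ q ∈ ΓK, ∀ v : V,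
      ((q : (V →ₗ[ℚ] V)ˣ) : V →ₗ[ℚ] V) v = v - (2 : ℚ) • (B v a • a) := by
    intro a ha
    have haL : a ∈ L := hLspan a ha
    obtain ⟨q, hq, hqv⟩ := hsq a haL.1
    refine ⟨q, hΓK.2 ⟨hq, hCsq a haL.1 q hqv, fun v hv => ?_⟩, hqv⟩
    rw [hqv, hLorth a haL v hv, zero_smul, smul_zero, sub_zero]
  -- basis vectors `b i`, `i ≤ k`, lie in `Λ_k`
  have hbL : ∀ i : Fin (n + 2), (i : ℕ) ≤ k → b i ∈ L := by
    intro i hi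
    refine ⟨hbmem i, fun j hj => ?_⟩
    rw [hdual, if_neg]
    intro hji
    rw [hji] at hj
    omega
  -- `g` fixes the dual vectors `yv j`, `j > k`
  have hgyv : ∀ j : Fin (n + 2), k < (j : ℕ) → (g : V →ₗ[ℚ] V) (yv j) = yv j := by
    intro j hj
    refine hfix (yv j) fun i hi => ?_
    rw [hdual, if_neg]
    intro hji
    rw [hji] at hj
    omega
  -- integrality of `⟨y, ·⟩` on `Λ`
  have hyint : ∀ a ∈ Submodule.span ℤ S, ∃ z : ℤ, B y a = z := by
    intro a ha
    obtain ⟨c, rfl⟩ := hcoord a ha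
    refine ⟨c kk, ?_⟩
    simp only [hydef, map_sum, map_smul, smul_eq_mul, hdual, mul_ite, mul_one, mul_zero,
      Finset.sum_ite_eq, Finset.mem_univ, if_true]
  -- the dual move: `g y = y + 2 c` with `c ∈ Λ_k`
  obtain ⟨c, hc, hgy⟩ := hdm y hyint g h2 h4
  have hcL : c ∈ L := by
    refine ⟨hc, fun j hj => ?_⟩
    have h0 : B (yv j) ((g : V →ₗ[ℚ] V) y) = B (yv j) y := by
      have e1 := h1 (yv j) y
      rwa [hgyv j hj] at e1
    rw [hgy, map_add, map_smul, smul_eq_mul] at h0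
    linarith
  -- the partner `g (b kk)` of `g y` lies in `Λ_k`
  have hgbL : (g : V →ₗ[ℚ] V) (b kk) ∈ L := by
    refine ⟨h2 _ (hbmem kk), fun j hj => ?_⟩
    conv_lhs => rw [← hgyv j hj, h1]
    rw [hdual, if_neg]
    intro hji
    rw [hji] at hj
    omega
  have hyb : B y (b kk) = 1 := by rw [hydef, hdual, if_pos rfl]
  have hpartner : B ((g : V →ₗ[ℚ] V) y) ((g : V →ₗ[ℚ] V) (b kk)) = 1 := by rw [h1, hyb]
  -- it suffices to find `q ∈ ΓK` moving `g y` back to `y`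
  suffices hq : ∃ q ∈ ΓK, ((q : (V →ₗ[ℚ] V)ˣ) : V →ₗ[ℚ] V) ((g : V →ₗ[ℚ] V) y) = y by
    obtain ⟨q, hq, hqy⟩ := hq
    obtain ⟨hqG, hqC, hqF⟩ := hΓK.1 hq
    exact ⟨q, hqG, hqC, hqF, hqy⟩
  -- case distinction on `k`
  rcases Nat.lt_or_ge k 2 with hk2 | hk2
  · rcases Nat.lt_or_ge k 1 with hk1 | hk1
    · -- k = 0: `c ∈ Λ₀ = ℤ u`, a power of `T_u²`
      have hk0 : k = 0 := by omega
      have hkk0 : kk = 0 := Fin.ext hk0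
      obtain ⟨cc, hcc⟩ := hcoord c hc
      have hcz : ∀ j : Fin (n + 2), j ≠ 0 → cc j = 0 := by
        intro j hj
        have hj' : k < (j : ℕ) := by
          rw [hk0]
          exact Nat.pos_of_ne_zero fun h => hj (Fin.ext h)
        have h := hcL.2 j hj'
        rw [hcc] at h
        simp only [map_sum, map_smul, smul_eq_mul, hdual, mul_ite, mul_one, mul_zero,
          Finset.sum_ite_eq, Finset.mem_univ, if_true] at h
        exact_mod_cast h
      have hcu : c = ((cc 0 : ℤ) : ℚ) • b 0 := by
        rw [hcc, Finset.sum_eq_single (0 : Fin (n + 2))]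
        · intro j _ hj
          rw [hcz j hj, Int.cast_zero, zero_smul]
        · intro h
          exact absurd (Finset.mem_univ _) h
      obtain ⟨q, hq, hqv⟩ := hsqL (b 0) (Submodule.subset_span (hbL 0 (by simp)))
      refine ⟨q ^ (cc 0), Subgroup.zpow_mem _ hq _, ?_⟩
      have hyu : B y (b 0) = 1 := by rw [hydef, hkk0, hdual, if_pos rfl]
      rw [localTubeSpan_sqMove_zpow_apply B hB (b 0) q hqv (cc 0), hgy, hcu]
      simp only [map_add, map_smul, LinearMap.add_apply, LinearMap.smul_apply, smul_eq_mul, hyu,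
        hB.self_eq_zero, mul_zero, add_zero]
      module
    · -- k = 1: `y = u`, the symmetric engine on the plane
      have hk1' : k = 1 := by omega
      have hkk1 : kk = 1 := Fin.ext hk1'
      -- `yv 1 = u` by nondegeneracy
      have hyu : y = b 0 := by
        rw [← sub_eq_zero]
        refine localTubeSpan_theoremUplus_eq_zero_of_orth B hnd S hsp b hcoord _ fun j => ?_
        rw [map_sub, LinearMap.sub_apply, hydef, hkk1, hdual]
        rcases Nat.lt_or_ge (j : ℕ) 2 with hj | hj
        · have : j = 0 ∨ j = 1 := by
            rcases Nat.lt_or_ge (j : ℕ) 1 with hj' | hj'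
            · exact Or.inl (Fin.ext (by simpa using Nat.lt_one_iff.1 hj'))
            · exact Or.inr (Fin.ext (by simp only [Fin.val_one]; omega))
          rcases this with rfl | rfl
          · rw [if_neg (by simp), hB.self_eq_zero, sub_zero]
          · rw [if_pos rfl, huw, sub_self]
        · rw [if_neg, ← hB.neg_eq, (hbo j hj).1, neg_zero, sub_zero]
          intro h1j
          rw [← h1j, Fin.val_one] at hj
          omega
      have huL : b 0 ∈ L := hbL 0 (by simp)
      have hwL : b 1 ∈ L := hbL 1 (by simp only [Fin.val_one]; omega)
      -- pair moves at `u`, `w` inside `ΓK` (three squares)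
      have hpairK : ∀ e ∈ ({b 0, b 1} : Set V), ∀ f ∈ Submodule.span ℤ L, B e f = 0 →
          ∃ p ∈ ΓK, ∀ v : V, ((p : (V →ₗ[ℚ] V)ˣ) : V →ₗ[ℚ] V) v = v + (2 : ℚ) • (B v e • f + B v f • e) := by
        intro e he f hf hef
        have heL : e ∈ Submodule.span ℤ L := by
          simp only [Set.mem_insert_iff, Set.mem_singleton_iff] at he
          rcases he with rfl | rfl
          · exact Submodule.subset_span huL
          · exact Submodule.subset_span hwL
        obtain ⟨ge, hge, hgev⟩ := hsqL e heL
        obtain ⟨gf, hgf, hgfv⟩ := hsqL f hf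
        obtain ⟨gef, hgef, hgefv⟩ := hsqL (e + f) (Submodule.add_mem _ heL hf)
        exact ⟨ge * gf * gef⁻¹, mul_mem (mul_mem hge hgf) (inv_mem hgef),
          localTubeSpan_threeSquares B hB hef ge gf gef hgev hgfv hgefv⟩
      have hsqK : ∀ a ∈ ({b 0, b 1, b 0 + b 1} : Set V), ∃ q ∈ ΓK, ∀ v : V,
          ((q : (V →ₗ[ℚ] V)ˣ) : V →ₗ[ℚ] V) v = v - (2 : ℚ) • (B v a • a) := by
        intro a ha
        simp only [Set.mem_insert_iff, Set.mem_singleton_iff] at ha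
        rcases ha with rfl | rfl | rfl
        · exact hsqL _ (Submodule.subset_span huL)
        · exact hsqL _ (Submodule.subset_span hwL)
        · exact hsqL _ (Submodule.add_mem _ (Submodule.subset_span huL) (Submodule.subset_span hwL))
      have ht : ∃ z ∈ Submodule.span ℤ L, (g : V →ₗ[ℚ] V) (b 0) = b 0 + (2 : ℚ) • z :=
        ⟨c, Submodule.subset_span hcL, by rw [← hyu, hgy]⟩
      have htu : ∃ y' ∈ Submodule.span ℤ L, B ((g : V →ₗ[ℚ] V) (b 0)) y' = 1 :=
        ⟨(g : V →ₗ[ℚ] V) (b kk), Submodule.subset_span hgbL, by rw [← hyu, hpartner]⟩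
      obtain ⟨q₀, hq₀, hq₀u⟩ := localTubeSpan_unimodularTransitivity_local B hB L hintL ΓK
        (Submodule.subset_span huL) (Submodule.subset_span hwL) huw hpairK hsqK ht htu
      refine ⟨q₀⁻¹, inv_mem hq₀, ?_⟩
      rw [hyu, ← hq₀u, localTubeSpan_units_inv_apply_apply]
  · -- k ≥ 2: the asymmetric engine in `Λ_k`
    have hk0 : (0 : Fin (n + 2)) ≠ kk := fun h => by rw [hkdef, ← h] at hk2; simp at hk2
    have hk1 : (1 : Fin (n + 2)) ≠ kk := fun h => by
      rw [hkdef, ← h] at hk2; simp at hk2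
    have huL : b 0 ∈ L := hbL 0 (by simp)
    have hwL : b 1 ∈ L := hbL 1 (by simp only [Fin.val_one]; omega)
    have hδL : b kk ∈ L := hbL kk le_rfl
    have hbo' := hbo kk hk2
    have hyu : B y (b 0) = 0 := by rw [hydef, hdual, if_neg (Ne.symm hk0)]
    have hyw : B y (b 1) = 0 := by rw [hydef, hdual, if_neg (Ne.symm hk1)]
    have hyintL : ∀ a ∈ Submodule.span ℤ L, ∃ z : ℤ, B y a = z := fun a ha =>
      hyint a (hLspan a ha).1
    exact heng L hintL ΓK hsqL (Submodule.subset_span huL) (Submodule.subset_span hwL)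
      (Submodule.subset_span hδL) huw hbo'.1 hbo'.2 y hyu hyw hyb hyintL
      ⟨c, Submodule.subset_span hcL, hgy⟩
      ⟨(g : V →ₗ[ℚ] V) (b kk), Submodule.subset_span hgbL, hpartner⟩

end Summit.HodgeConjecture.HodgeConjecture.Theorems

end
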